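/-
Copyright (c) 2026 the pub-hodgecm-mathlib formalisation cell (harness21).  Prover seat hodgecm-mathlib-K2E3-p11 (g5), Track B «K2-LIT» ∕ h413
(`stmt-HodgeConjecture-24833`), line `K2_E3_EllipticInputs`, unit U12 §L, Richardson road for (LBGL-ge3) at `N = 3` (road owner K2E3-p11), brick (F-E) =
(LBGL-3E) «THE (2,1)-PARABOLIC SLICE DENSITY OF 𝔤𝔩₃(F)», FILE H″2 «THE LOCAL DENSITY AT A LEVI POINT WITH ELLIPTIC `A`: one piece».  2026-09-04.
-/
import Summits.HodgeConjecture.HodgeConjecture.Theorems.K2E3GL3ParabolicFibreExhaustion      -- ★ EXHAUST p857815 (K2E3-p21 g4): `exists_level_of_conj_mem_box_of_forall_eval_ne_zero`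
import Literature.NumberTheory.Automorphic.AddCharConductorExponent                          -- ★ `primePowBall_antitone`
import Mathlib.MeasureTheory.Integral.Lebesgue.Basic
import HarnessLib

/-!
# K2_E3 road (h413), §L ∕ Richardson road at `N = 3`, brick (F-E) FILE H″2: the local density at a Levi point whose `2 × 2` block is elliptic

Cell `pub/hodgecm-mathlib` (D-0151), Track B, seat K2E3-p11 (g5) (road owner of (F-E) = (LBGL-3E) `sig_K2E3GL3ParabolicSliceDensity`; ROAD v2 on `K2/STATUS.md`,
2026-09-04).  `--supports stmt-HodgeConjecture-24833 --as helper`; THEOREMS ONLY (no definition ∕ instance ∕ notation ∕ named fact ∕ `sorry`); never imports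
`Cruxes/…/Lines`.  COUNT-NEUTRAL.

THE POINT.  Let `M(m) = [[m₀,m₁,0],[m₂,m₃,0],[0,0,m₄]]` with `A = [[m₀,m₁],[m₂,m₃]]` ELLIPTIC over `F` (`χ_A(t) ≠ 0` for all `t ∈ F`; in particular `χ(m) = χ_A(m₄) ≠ 0`).
Then near `M(m)` the (2,1)-parabolic slice `ρ(h) = ∫_K ∫_𝔭 h(Ad(k)P) dP dk` has exactly ONE fibre piece: by ★ EXHAUST (a), `Ad(k)P ∈ B_J(m) = M(m) + M₃(𝔭^J)` forces
`k₂₀, k₂₁ ∈ 𝔭^{J−c}`, so the WHOLE `K`-integral of `1_{B_J(m)}·h` is the level-set piece, and the piece integral (★ H″1, taken here as the HYPOTHESIS `hball` so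
that the universal constant `C` is shared with the split case H″3 and the gluing H″6) gives
  `ρ(1_{B_J(m)}·h) = C · ‖χ(m)‖_F⁻¹ · ∫⁻_{B_J(m)} h dμ𝔤`      for all deep enough `J` and all measurable `h ≥ 0`.
* **`lintegral_parabolicSlice_ball_indicator_eq_of_forall_eval_ne_zero`**.
[HarishChandra1999AdmissibleDistributions, §7 Lemma 7.8] [HarishChandra1970, Part V §4 Lemma 22]
HONEST LABEL: HC_CM is proved only modulo the 7 printed citations (2 remaining named inputs: hLiu418 = stmt-HodgeConjecture-24832, h413 = stmt-HodgeConjecture-24833)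
until rung 0 closes; count-neutral helper ((LBGL-ge3)∕(LBGL-3E) NOT ★ here).

## References
* [HarishChandra1999AdmissibleDistributions] Harish-Chandra (DeBacker–Sally), *Admissible Invariant Distributions on Reductive p-adic Groups* (1999), §7, Lemma 7.8.
* [HarishChandra1970] Harish-Chandra (van Dijk), *Harmonic Analysis on Reductive p-adic Groups*, LNM 162 (1970), Part V §4 Lemma 22.
-/

set_option autoImplicit false
set_option linter.dupNamespace false

noncomputable section

open MeasureTheory Measure Filter Topology Set Matrix
open scoped MatrixGroups NNReal ENNReal
open Literature.NumberTheory.Automorphic Literature.NumberTheory.Automorphic.LocalFieldHaar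
open Literature.NumberTheory.GaloisRepresentations Literature.NumberTheory.GaloisRepresentations.IsNonarchimedeanLocalField

namespace Summit.HodgeConjecture.HodgeConjecture.Cruxes.H413.K2E3GL3ParabolicSliceLocalDensityElliptic

variable {F : Type*} [Field F] [ValuativeRel F] [TopologicalSpace F] [IsNonarchimedeanLocalField F]
  [MeasurableSpace F] [BorelSpace F]
  [MeasurableSpace (Matrix (Fin 3) (Fin 3) F)] [BorelSpace (Matrix (Fin 3) (Fin 3) F)]
  [MeasurableSpace (GL (Fin 3) F)] [BorelSpace (GL (Fin 3) F)]

omit [MeasurableSpace (Matrix (Fin 3) (Fin 3) F)] [BorelSpace (Matrix (Fin 3) (Fin 3) F)] in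
/-- The level set `{k ∈ GL₃(𝒪) | k₂₀, k₂₁ ∈ 𝔭^{j}}` is measurable. [folklore] -/
theorem measurableSet_levelSet (j : ℕ) :
    MeasurableSet {k : ↥(glInt 3 F) | ((k : GL (Fin 3) F) : Matrix (Fin 3) (Fin 3) F) 2 0 ∈ primePowBall F j ∧
      ((k : GL (Fin 3) F) : Matrix (Fin 3) (Fin 3) F) 2 1 ∈ primePowBall F j} := by
  have hc : Continuous fun k : ↥(glInt 3 F) => ((k : GL (Fin 3) F) : Matrix (Fin 3) (Fin 3) F) :=
    Units.continuous_val.comp continuous_subtype_val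
  exact ((measurableSet_primePowBall (F := F) _).preimage (hc.matrix_elem 2 0).measurable).inter
    ((measurableSet_primePowBall (F := F) _).preimage (hc.matrix_elem 2 1).measurable)

omit [BorelSpace (Matrix (Fin 3) (Fin 3) F)] in
/-- **THE LOCAL DENSITY AT A LEVI POINT WITH ELLIPTIC `A`.**  `κ` a Haar measure on `K = GL₃(𝒪)`, `dx`, `μ𝔤` additive Haar measures on `F`, `𝔤𝔩₃(F)`; `C` a constant for
which the BALL PIECE FORMULA `hball` holds (★ H″1 `exists_lintegral_levelSet_ball_indicator_eq` provides one).  If `χ_A` has no root in `F` then for all deep `J` and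
measurable `h ≥ 0`:
`∫⁻_K ∫⁻_{F⁷} (1_{B_J(m)}·h)(k·P(r)·k⁻¹) dr dκ = C · ‖χ(m)‖_F⁻¹ · ∫⁻_{B_J(m)} h dμ𝔤`, `B_J(m) = M(m) + M₃(𝔭^J)` — the `K`-integral IS the level-set piece by ★ EXHAUST (a).
[cite: HarishChandra1999AdmissibleDistributions, §7 Lemma 7.8] [cite: HarishChandra1970, Part V §4 Lemma 22] -/
theorem lintegral_parabolicSlice_ball_indicator_eq_of_forall_eval_ne_zero
    (κ : Measure ↥(glInt 3 F)) (dx : Measure F) (μ𝔤 : Measure (Matrix (Fin 3) (Fin 3) F)) (C : ℝ≥0∞)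
    (hball : ∀ m : Fin 5 → F, (!![m 0, m 1; m 2, m 3] : Matrix (Fin 2) (Fin 2) F).charpoly.eval (m 4) ≠ 0 →
      ∃ j₀ c₁ : ℕ, ∀ j' J : ℕ, j₀ ≤ j' → j' + c₁ ≤ J → ∀ h : Matrix (Fin 3) (Fin 3) F → ℝ≥0∞, Measurable h →
        ∫⁻ k in {k : ↥(glInt 3 F) | ((k : GL (Fin 3) F) : Matrix (Fin 3) (Fin 3) F) 2 0 ∈ primePowBall F j' ∧
            ((k : GL (Fin 3) F) : Matrix (Fin 3) (Fin 3) F) 2 1 ∈ primePowBall F j'},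
          ∫⁻ r : Fin 7 → F,
            ({X : Matrix (Fin 3) (Fin 3) F | ∀ i l, (X - !![m 0, m 1, 0; m 2, m 3, 0; 0, 0, m 4]) i l ∈ primePowBall F (J : ℤ)}).indicator h
              (((k : GL (Fin 3) F) : Matrix (Fin 3) (Fin 3) F) * !![r 0, r 1, r 2; r 3, r 4, r 5; 0, 0, r 6] *
                ((((k : GL (Fin 3) F))⁻¹ : GL (Fin 3) F) : Matrix (Fin 3) (Fin 3) F))
            ∂(Measure.pi fun _ : Fin 7 => dx) ∂κ =
          C * ((normAbs F ((!![m 0, m 1; m 2, m 3] : Matrix (Fin 2) (Fin 2) F).charpoly.eval (m 4)))⁻¹ : ℝ≥0) *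
            ∫⁻ X in {X : Matrix (Fin 3) (Fin 3) F | ∀ i l, (X - !![m 0, m 1, 0; m 2, m 3, 0; 0, 0, m 4]) i l ∈ primePowBall F (J : ℤ)}, h X ∂μ𝔤)
    (m : Fin 5 → F) (hA : ∀ t : F, (!![m 0, m 1; m 2, m 3] : Matrix (Fin 2) (Fin 2) F).charpoly.eval t ≠ 0) :
    ∃ J₀ : ℕ, ∀ J : ℕ, J₀ ≤ J → ∀ h : Matrix (Fin 3) (Fin 3) F → ℝ≥0∞, Measurable h →
      ∫⁻ k : ↥(glInt 3 F), ∫⁻ r : Fin 7 → F,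
          ({X : Matrix (Fin 3) (Fin 3) F | ∀ i l, (X - !![m 0, m 1, 0; m 2, m 3, 0; 0, 0, m 4]) i l ∈ primePowBall F (J : ℤ)}).indicator h
            (((k : GL (Fin 3) F) : Matrix (Fin 3) (Fin 3) F) * !![r 0, r 1, r 2; r 3, r 4, r 5; 0, 0, r 6] *
              ((((k : GL (Fin 3) F))⁻¹ : GL (Fin 3) F) : Matrix (Fin 3) (Fin 3) F))
          ∂(Measure.pi fun _ : Fin 7 => dx) ∂κ =
        C * ((normAbs F ((!![m 0, m 1; m 2, m 3] : Matrix (Fin 2) (Fin 2) F).charpoly.eval (m 4)))⁻¹ : ℝ≥0) *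
          ∫⁻ X in {X : Matrix (Fin 3) (Fin 3) F | ∀ i l, (X - !![m 0, m 1, 0; m 2, m 3, 0; 0, 0, m 4]) i l ∈ primePowBall F (J : ℤ)}, h X ∂μ𝔤 := by
  classical
  have hm : (!![m 0, m 1; m 2, m 3] : Matrix (Fin 2) (Fin 2) F).charpoly.eval (m 4) ≠ 0 := hA (m 4)
  obtain ⟨j₀, c₁, hb⟩ := hball m hm
  obtain ⟨c, J₀', hex⟩ := K2E3GL3ParabolicFibreExhaustion.exists_level_of_conj_mem_box_of_forall_eval_ne_zero m hA
  -- one common shift `cN ≥ c, c₁`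
  set cN : ℕ := max c.toNat c₁ with hcN
  refine ⟨max J₀'.toNat (j₀ + cN), fun J hJ h hh => ?_⟩
  obtain ⟨j', hj'⟩ : ∃ j' : ℕ, j' + cN = J := ⟨J - cN, by omega⟩
  have hj'₀ : j₀ ≤ j' := by omega
  have hJ' : J₀' ≤ (J : ℤ) := by
    have : J₀'.toNat ≤ J := le_trans (le_max_left _ _) hJ
    omega
  have hcle : (j' : ℤ) ≤ (J : ℤ) - c := by
    have h1 : c ≤ (c.toNat : ℤ) := Int.self_le_toNat c
    have h2 : c.toNat ≤ cN := le_max_left _ _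
    omega
  set M₀ : Matrix (Fin 3) (Fin 3) F := !![m 0, m 1, 0; m 2, m 3, 0; 0, 0, m 4] with hM₀
  set B : Set (Matrix (Fin 3) (Fin 3) F) := {X : Matrix (Fin 3) (Fin 3) F | ∀ i l, (X - M₀) i l ∈ primePowBall F (J : ℤ)} with hB
  set S : Set ↥(glInt 3 F) := {k : ↥(glInt 3 F) | ((k : GL (Fin 3) F) : Matrix (Fin 3) (Fin 3) F) 2 0 ∈ primePowBall F j' ∧
      ((k : GL (Fin 3) F) : Matrix (Fin 3) (Fin 3) F) 2 1 ∈ primePowBall F j'} with hS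
  have hSm : MeasurableSet S := measurableSet_levelSet (F := F) j'
  -- ★ EXHAUST (a): off the level set the integrand vanishes identically
  have hzero : ∀ k : ↥(glInt 3 F), k ∉ S → ∀ r : Fin 7 → F,
      B.indicator h (((k : GL (Fin 3) F) : Matrix (Fin 3) (Fin 3) F) * !![r 0, r 1, r 2; r 3, r 4, r 5; 0, 0, r 6] *
        ((((k : GL (Fin 3) F))⁻¹ : GL (Fin 3) F) : Matrix (Fin 3) (Fin 3) F)) = 0 := by
    intro k hk r
    refine Set.indicator_of_notMem (fun hmem => hk ?_) _
    have h := hex (J : ℤ) hJ' (k : GL (Fin 3) F) k.2 (!![r 0, r 1, r 2; r 3, r 4, r 5; 0, 0, r 6]) (by simp) (by simp) hmem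
    exact ⟨primePowBall_antitone hcle h.1, primePowBall_antitone hcle h.2⟩
  have hrestrict : ∫⁻ k : ↥(glInt 3 F), ∫⁻ r : Fin 7 → F,
        B.indicator h (((k : GL (Fin 3) F) : Matrix (Fin 3) (Fin 3) F) * !![r 0, r 1, r 2; r 3, r 4, r 5; 0, 0, r 6] *
          ((((k : GL (Fin 3) F))⁻¹ : GL (Fin 3) F) : Matrix (Fin 3) (Fin 3) F)) ∂(Measure.pi fun _ : Fin 7 => dx) ∂κ =
      ∫⁻ k in S, ∫⁻ r : Fin 7 → F,
        B.indicator h (((k : GL (Fin 3) F) : Matrix (Fin 3) (Fin 3) F) * !![r 0, r 1, r 2; r 3, r 4, r 5; 0, 0, r 6] *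
          ((((k : GL (Fin 3) F))⁻¹ : GL (Fin 3) F) : Matrix (Fin 3) (Fin 3) F)) ∂(Measure.pi fun _ : Fin 7 => dx) ∂κ := by
    rw [← lintegral_indicator hSm]
    refine lintegral_congr fun k => ?_
    by_cases hk : k ∈ S
    · rw [Set.indicator_of_mem hk]
    · rw [Set.indicator_of_notMem hk]
      simp only [hzero k hk, lintegral_zero]
  rw [hrestrict]
  exact hb j' J hj'₀ (by omega) h hh

end Summit.HodgeConjecture.HodgeConjecture.Cruxes.H413.K2E3GL3ParabolicSliceLocalDensityElliptic

end
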